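import Summits.QuantumFields.YangMills.Theorems.SwapTwistDeficitToronLogQuaternion
import HarnessLib

/-!
# The toron logarithm, II: the shell event and its product-cone-measure mass (Fubini over the axis letter)

Second of three files toward ★ `ToronLog.haar_pi_nearlyCommuting_ge`.  In the ball model of Haar measure on `SU(2)`
(✓`haarProbability_su2_eq_su2BallMeasure`: Haar = radial projection of the normalised Lebesgue measure of the unit ball of `ℍ`):
* §6 the SHELL EVENT `shellSet ρ δ ⊆ ℍ⁴`: `x 0` in the axis box `re ∈ [½,¾], im_I ∈ [ρ, 3ρ/2], |im_J|,|im_K| ≤ ρ/4`, and `x 1, x 2, x 3` in the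
  thin box `re ∈ [½,¾], |im_I| ≤ 2ρ, |im_J|,|im_K| ≤ δ/2` ROTATED onto the imaginary axis of `x 0` (✓`fiber`); ★ `shellSet_subset`: on it every
  letter is in the unit ball and the normalised letters pairwise commute up to `24ρδ` (`0 ≤ δ ≤ ρ ≤ 1/16`);
* §7 `coneMeasure` (normalised Lebesgue measure of the ball), `measurePreserving_quatToSU2` / `measurePreserving_proj` (its letter-wise radial
  projection is product Haar measure), and ★ `pi_coneMeasure_shellSet`: the product cone mass of the shell event is EXACTLY
  `c⁴·(ρδ)⁶/32`, `c = vol(B⁴)⁻¹ = 2/π²` (Fubini over `x 0` via `measurePreserving_piFinSuccAbove`; each fibre is a product of three rotated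
  boxes of volume `ρδ²`; the axis box has volume `ρ³/32`) — independent of `ρ` once `ρδ` is fixed, which is the source of the logarithm.
HONEST LABEL: finite-dimensional volume bookkeeping; nothing about ⟨23802⟩/⟨24196⟩ or any rung is proved; the Yang–Mills mass gap is NOT
proved; no summit is proved by a line.  Width seat ym-line-sfw-p2-w2 g54 (cell ym-idea-1, free hands; `--supports stmt-QuantumFields-23802`).
THEOREMS ONLY (0 `def`), 0 `sorry`, standard axioms.  References: [cite: Vanbaal2001]; [cite: Luscher1983, §2]; [folklore].
-/

set_option autoImplicit false

noncomputable section

open MeasureTheory Quaternion Set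
open scoped Quaternion ENNReal BigOperators
open Literature.MathematicalPhysics.QuantumLattice
open Literature.MathematicalPhysics.QuantumFieldTheory (haarProbability)

attribute [local instance] Literature.Analysis.FluidPDE.Tao2016.quatMeasurableSpace
  Literature.Analysis.FluidPDE.Tao2016.quatBorelSpace
  Literature.MathematicalPhysics.QuantumLattice.secondCountableTopology_su2

namespace Summit.QuantumFields.YangMills.Theorems.SwapTwistDeficit.ToronLog

/-! ## §6 The shell event: `x₀` in an axis box at height `≍ ρ`, `x₁,x₂,x₃` in the rotated thin box -/

/-- Unfolding membership in the thin box. [folklore] -/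
theorem mem_thin_iff {ρ δ : ℝ} {z : ℍ} : z ∈ quatBox (thinLo ρ δ) (thinHi ρ δ) ↔
    1 / 2 ≤ z.re ∧ z.re ≤ 3 / 4 ∧ -(2 * ρ) ≤ z.imI ∧ z.imI ≤ 2 * ρ ∧ -(δ / 2) ≤ z.imJ ∧ z.imJ ≤ δ / 2 ∧
      -(δ / 2) ≤ z.imK ∧ z.imK ≤ δ / 2 := by
  simp [quatBox, thinLo, thinHi]

/-- Unfolding membership in the axis box. [folklore] -/
theorem mem_axis_iff {ρ : ℝ} {z : ℍ} : z ∈ quatBox (axisLo ρ) (axisHi ρ) ↔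
    1 / 2 ≤ z.re ∧ z.re ≤ 3 / 4 ∧ ρ ≤ z.imI ∧ z.imI ≤ 3 * ρ / 2 ∧ -(ρ / 4) ≤ z.imJ ∧ z.imJ ≤ ρ / 4 ∧
      -(ρ / 4) ≤ z.imK ∧ z.imK ≤ ρ / 4 := by
  simp [quatBox, axisLo, axisHi]

/-- Elements of the thin box have norm in `[½, 1)` (for `δ ≤ ρ ≤ 1/16`). [folklore] -/
theorem norm_bounds_of_mem_thin {ρ δ : ℝ} (hρ : ρ ≤ 1 / 16) (hδ : 0 ≤ δ) (hδρ : δ ≤ ρ) {z : ℍ}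
    (hz : z ∈ quatBox (thinLo ρ δ) (thinHi ρ δ)) : 1 / 2 ≤ ‖z‖ ∧ ‖z‖ < 1 := by
  rw [mem_thin_iff] at hz
  obtain ⟨h1, h2, h3, h4, h5, h6, h7, h8⟩ := hz
  have hsq := sq_norm_eq_sum_sq z
  have hn : 0 ≤ ‖z‖ := norm_nonneg z
  have hI : z.imI ^ 2 ≤ (2 * ρ) ^ 2 := sq_le_sq' h3 h4
  have hJ : z.imJ ^ 2 ≤ (δ / 2) ^ 2 := sq_le_sq' h5 h6
  have hK : z.imK ^ 2 ≤ (δ / 2) ^ 2 := sq_le_sq' h7 h8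
  constructor
  · nlinarith
  · nlinarith

/-- Elements of the axis box have norm `< 1` and positive `im_I` (for `0 < ρ ≤ 1/16`). [folklore] -/
theorem norm_lt_one_of_mem_axis {ρ : ℝ} (hρ0 : 0 < ρ) (hρ : ρ ≤ 1 / 16) {z : ℍ}
    (hz : z ∈ quatBox (axisLo ρ) (axisHi ρ)) : ‖z‖ < 1 ∧ 0 < z.imI := by
  rw [mem_axis_iff] at hz
  obtain ⟨h1, h2, h3, h4, h5, h6, h7, h8⟩ := hz
  have hsq := sq_norm_eq_sum_sq z
  have hn : 0 ≤ ‖z‖ := norm_nonneg z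
  have hI : z.imI ^ 2 ≤ (3 * ρ / 2) ^ 2 := sq_le_sq' (by linarith) h4
  have hJ : z.imJ ^ 2 ≤ (ρ / 4) ^ 2 := sq_le_sq' h5 h6
  have hK : z.imK ^ 2 ≤ (ρ / 4) ^ 2 := sq_le_sq' h7 h8
  constructor
  · nlinarith
  · linarith

/-- The straightening of `y₀` itself lies in the thin box when `y₀` is in the axis box. [folklore] -/
theorem straighten_self_mem_thin {ρ δ : ℝ} (hδ : 0 ≤ δ) {y₀ : ℍ} (hy : y₀ ∈ quatBox (axisLo ρ) (axisHi ρ)) :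
    axisPoint y₀ ∈ quatBox (thinLo ρ δ) (thinHi ρ δ) := by
  rw [mem_axis_iff] at hy
  obtain ⟨h1, h2, h3, h4, h5, h6, h7, h8⟩ := hy
  have hρ : 0 ≤ ρ := by nlinarith
  have hn : 0 ≤ ‖y₀.im‖ := norm_nonneg _
  have him := WeakCouplingRates.sq_norm_im y₀
  have hI : y₀.imI ^ 2 ≤ (3 * ρ / 2) ^ 2 := sq_le_sq' (by linarith) h4
  have hJ : y₀.imJ ^ 2 ≤ (ρ / 4) ^ 2 := sq_le_sq' h5 h6
  have hK : y₀.imK ^ 2 ≤ (ρ / 4) ^ 2 := sq_le_sq' h7 h8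
  have hle : ‖y₀.im‖ ≤ 2 * ρ := by nlinarith
  rw [mem_thin_iff]
  simp only [axisPoint]
  refine ⟨h1, h2, by linarith, hle, by linarith, by linarith, by linarith, by linarith⟩

/-- Straightening preserves the norm. [folklore] -/
theorem norm_straighten {y₀ : ℍ} (hy : 0 < y₀.imI) (y : ℍ) :
    ‖(normSq (coneQ y₀))⁻¹ • (coneQstar y₀ * y * coneQ y₀)‖ = ‖y‖ := by
  have hN := normSq_coneQ_pos hy
  have hq : ‖coneQ y₀‖ ≠ 0 := norm_ne_zero_iff.2 (coneQ_ne_zero hy)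
  rw [norm_smul, norm_mul, norm_mul, ← star_coneQ, norm_star, Real.norm_eq_abs, abs_inv, abs_of_pos hN,
    normSq_eq_norm_mul_self]
  field_simp

/-- The straightening of `y₀` is `re y₀ + ‖Im y₀‖·i`. [folklore] -/
theorem straighten_self {y₀ : ℍ} (hy : 0 < y₀.imI) :
    (normSq (coneQ y₀))⁻¹ • (coneQstar y₀ * y₀ * coneQ y₀) = axisPoint y₀ := by
  rw [coneQ_conj]
  exact inv_smul_smul₀ (normSq_coneQ_pos hy).ne' _

/-- Two elements of the thin box almost commute: `‖zw − wz‖ ≤ 6ρδ`. [folklore] -/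
theorem norm_comm_le_of_mem_thin {ρ δ : ℝ} (hδ : 0 ≤ δ) (hδρ : δ ≤ ρ) {z w : ℍ}
    (hz : z ∈ quatBox (thinLo ρ δ) (thinHi ρ δ)) (hw : w ∈ quatBox (thinLo ρ δ) (thinHi ρ δ)) :
    ‖z * w - w * z‖ ≤ 6 * ρ * δ := by
  rw [mem_thin_iff] at hz hw
  exact norm_comm_le_of_box hδ hδρ (abs_le.2 ⟨hz.2.2.1, hz.2.2.2.1⟩) (abs_le.2 ⟨hz.2.2.2.2.1, hz.2.2.2.2.2.1⟩)
    (abs_le.2 ⟨hz.2.2.2.2.2.2.1, hz.2.2.2.2.2.2.2⟩) (abs_le.2 ⟨hw.2.2.1, hw.2.2.2.1⟩)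
    (abs_le.2 ⟨hw.2.2.2.2.1, hw.2.2.2.2.2.1⟩) (abs_le.2 ⟨hw.2.2.2.2.2.2.1, hw.2.2.2.2.2.2.2⟩)

/-- **On the shell event every letter lies in the unit ball of `ℍ` and the normalised letters pairwise almost commute**:
`‖q(x_μ) q(x_ν) − q(x_ν) q(x_μ)‖ ≤ 24ρδ` for the unit quaternions `q(x_μ) = x_μ/‖x_μ‖ = su2Quat (quatToSU2 x_μ)`. [folklore] -/
theorem shellSet_subset {ρ δ : ℝ} (hρ0 : 0 < ρ) (hρ : ρ ≤ 1 / 16) (hδ : 0 ≤ δ) (hδρ : δ ≤ ρ) {x : Fin 4 → ℍ}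
    (hx : x ∈ shellSet ρ δ) :
    (∀ μ, x μ ∈ Metric.ball (0 : ℍ) 1) ∧
      ∀ μ ν, ‖su2Quat (quatToSU2 (x μ)) * su2Quat (quatToSU2 (x ν)) -
        su2Quat (quatToSU2 (x ν)) * su2Quat (quatToSU2 (x μ))‖ ≤ 24 * ρ * δ := by
  obtain ⟨h0, hj⟩ := hx
  have hyI : 0 < (x 0).imI := (norm_lt_one_of_mem_axis hρ0 hρ h0).2
  set N := normSq (coneQ (x 0)) with hNdef
  have hN : 0 < N := normSq_coneQ_pos hyI
  -- the straightened letters all lie in the thin box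
  have hz : ∀ μ, N⁻¹ • (coneQstar (x 0) * x μ * coneQ (x 0)) ∈ quatBox (thinLo ρ δ) (thinHi ρ δ) := by
    intro μ
    refine Fin.cases ?_ (fun j => ?_) μ
    · rw [hNdef, straighten_self hyI]
      exact straighten_self_mem_thin hδ h0
    · exact hj j
  -- norms of the letters
  have hnorm : ∀ μ, 1 / 2 ≤ ‖x μ‖ ∧ ‖x μ‖ < 1 := by
    intro μ
    have h := norm_bounds_of_mem_thin hρ hδ hδρ (hz μ)
    rwa [hNdef, norm_straighten hyI] at h
  refine ⟨fun μ => by simpa using (hnorm μ).2, fun μ ν => ?_⟩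
  have hμ0 : x μ ≠ 0 := by
    intro h; have := (hnorm μ).1; rw [h, norm_zero] at this; linarith
  have hν0 : x ν ≠ 0 := by
    intro h; have := (hnorm ν).1; rw [h, norm_zero] at this; linarith
  -- the commutator is that of the straightened letters
  have hcomm : ‖x μ * x ν - x ν * x μ‖ ≤ 6 * ρ * δ := by
    rw [norm_comm_eq_of_conj (coneQ_ne_zero hyI) (x μ) (x ν), star_coneQ]
    exact norm_comm_le_of_mem_thin hδ hδρ (hz μ) (hz ν)
  rw [Literature.MathematicalPhysics.QuantumFieldTheory.Balaban1983to89.T4HaarSU2Translate.su2Quat_quatToSU2 hμ0, Literature.MathematicalPhysics.QuantumFieldTheory.Balaban1983to89.T4HaarSU2Translate.su2Quat_quatToSU2 hν0, norm_comm_smul, abs_inv, abs_inv, abs_of_nonneg (norm_nonneg _),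
    abs_of_nonneg (norm_nonneg _)]
  have h1 : ‖x μ‖⁻¹ ≤ 2 := by
    rw [inv_le_comm₀ (by linarith [(hnorm μ).1]) (by norm_num)]; linarith [(hnorm μ).1]
  have h2 : ‖x ν‖⁻¹ ≤ 2 := by
    rw [inv_le_comm₀ (by linarith [(hnorm ν).1]) (by norm_num)]; linarith [(hnorm ν).1]
  have h3 : 0 ≤ ‖x μ‖⁻¹ := inv_nonneg.2 (norm_nonneg _)
  have h4 : 0 ≤ ‖x ν‖⁻¹ := inv_nonneg.2 (norm_nonneg _)
  calc ‖x μ‖⁻¹ * ‖x ν‖⁻¹ * ‖x μ * x ν - x ν * x μ‖ ≤ 2 * 2 * (6 * ρ * δ) := by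
        gcongr
    _ = 24 * ρ * δ := by ring

/-- A letter of the rotated thin box lies in the unit ball. [folklore] -/
theorem fiber_subset_ball {ρ δ : ℝ} (hρ : ρ ≤ 1 / 16) (hδ : 0 ≤ δ) (hδρ : δ ≤ ρ) {y₀ : ℍ} (hy : 0 < y₀.imI) :
    fiber (thinLo ρ δ) (thinHi ρ δ) y₀ ⊆ Metric.ball 0 1 := by
  intro y hyf
  have h := norm_bounds_of_mem_thin hρ hδ hδρ hyf
  rw [norm_straighten hy] at h
  simpa using h.2

/-- The axis box lies in the unit ball. [folklore] -/
theorem axis_subset_ball {ρ : ℝ} (hρ0 : 0 < ρ) (hρ : ρ ≤ 1 / 16) :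
    quatBox (axisLo ρ) (axisHi ρ) ⊆ Metric.ball 0 1 := by
  intro y hy
  simpa using (norm_lt_one_of_mem_axis hρ0 hρ hy).1


/-! ## §7 The cone measure of the unit ball (whose radial projection is Haar) and the mass of the shell event -/

/-- `vol(B⁴)⁻¹` is finite. [folklore] -/
theorem inv_volume_ball_ne_top : ((volume : Measure ℍ) (Metric.ball 0 1))⁻¹ ≠ ∞ :=
  ENNReal.inv_ne_top.2 volume_ball_quat_ne_zero

/-- `vol(B⁴)⁻¹ = ofReal coneConst`. [folklore] -/
theorem inv_volume_ball_eq : ((volume : Measure ℍ) (Metric.ball 0 1))⁻¹ = ENNReal.ofReal coneConst := by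
  rw [coneConst, ENNReal.ofReal_toReal inv_volume_ball_ne_top]

/-- `coneConst > 0`. [folklore] -/
theorem coneConst_pos : 0 < coneConst :=
  ENNReal.toReal_pos (ENNReal.inv_ne_zero.2 volume_ball_quat_ne_top) inv_volume_ball_ne_top

/-- The cone measure of a measurable subset of the ball is `vol(B⁴)⁻¹ ·` its volume. [folklore] -/
theorem coneMeasure_apply {A : Set ℍ} (hA : MeasurableSet A) (hAB : A ⊆ Metric.ball 0 1) :
    coneMeasure A = ((volume : Measure ℍ) (Metric.ball 0 1))⁻¹ * volume A := by
  rw [coneMeasure, Measure.smul_apply, Measure.restrict_apply hA, Set.inter_eq_left.2 hAB, smul_eq_mul]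

/-- The cone measure is a probability measure. [folklore] -/
theorem isProbabilityMeasure_coneMeasure : IsProbabilityMeasure coneMeasure := by
  refine ⟨?_⟩
  rw [coneMeasure, Measure.smul_apply, Measure.restrict_apply MeasurableSet.univ, Set.univ_inter, smul_eq_mul,
    ENNReal.inv_mul_cancel volume_ball_quat_ne_zero volume_ball_quat_ne_top]

/-- **Radial projection of the cone measure is Haar measure on `SU(2)`.** [folklore] -/
theorem measurePreserving_quatToSU2 : MeasurePreserving quatToSU2 coneMeasure (haarProbability (Matrix.specialUnitaryGroup (Fin 2) ℂ)) := by
  refine ⟨measurable_quatToSU2, ?_⟩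
  rw [haarProbability_su2_eq_su2BallMeasure, su2BallMeasure, coneMeasure, Measure.map_smul]

/-- Letter-wise radial projection `ℍ⁴ → SU(2)⁴` maps the product cone measure to product Haar measure. [folklore] -/
theorem measurePreserving_proj :
    MeasurePreserving (fun (x : Fin 4 → ℍ) (μ : Fin 4) => quatToSU2 (x μ)) (Measure.pi fun _ : Fin 4 => coneMeasure)
      (Measure.pi fun _ : Fin 4 => haarProbability (Matrix.specialUnitaryGroup (Fin 2) ℂ)) :=
  measurePreserving_pi (fun _ : Fin 4 => coneMeasure) (fun _ : Fin 4 => haarProbability (Matrix.specialUnitaryGroup (Fin 2) ℂ))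
    fun _ => measurePreserving_quatToSU2

/-- The rotated box is measurable. [folklore] -/
theorem measurableSet_fiber (lo hi : Fin 4 → ℝ) (y₀ : ℍ) : MeasurableSet (fiber lo hi y₀) := by
  have hg : Measurable fun y : ℍ => coneQstar y₀ * y * coneQ y₀ :=
    ((continuous_const.mul continuous_id).mul continuous_const).measurable
  have hm : Measurable fun y : ℍ => (normSq (coneQ y₀))⁻¹ • (coneQstar y₀ * y * coneQ y₀) :=
    (measurable_const_smul _).comp hg
  exact hm (measurableSet_quatBox lo hi)

/-- The product form is measurable. [folklore] -/
theorem measurableSet_shellProd (ρ δ : ℝ) : MeasurableSet (shellProd ρ δ) := by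
  have h1 : MeasurableSet ((fun p : ℍ × (Fin 3 → ℍ) => p.1) ⁻¹' quatBox (axisLo ρ) (axisHi ρ)) :=
    measurable_fst (measurableSet_quatBox _ _)
  have h2 : ∀ j : Fin 3, MeasurableSet
      ((fun p : ℍ × (Fin 3 → ℍ) => (normSq (coneQ p.1))⁻¹ • (coneQstar p.1 * p.2 j * coneQ p.1)) ⁻¹'
        quatBox (thinLo ρ δ) (thinHi ρ δ)) := by
    intro j
    have hf : Measurable fun p : ℍ × (Fin 3 → ℍ) => (normSq (coneQ p.1))⁻¹ :=
      ((continuous_normSq.comp (continuous_coneQ.comp continuous_fst)).measurable).inv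
    have hg : Measurable fun p : ℍ × (Fin 3 → ℍ) => coneQstar p.1 * p.2 j * coneQ p.1 :=
      (((continuous_coneQstar.comp continuous_fst).mul ((continuous_apply j).comp continuous_snd)).mul
        (continuous_coneQ.comp continuous_fst)).measurable
    exact (hf.smul hg) (measurableSet_quatBox _ _)
  have e : shellProd ρ δ = ((fun p : ℍ × (Fin 3 → ℍ) => p.1) ⁻¹' quatBox (axisLo ρ) (axisHi ρ)) ∩
      ⋂ j : Fin 3, ((fun p : ℍ × (Fin 3 → ℍ) => (normSq (coneQ p.1))⁻¹ • (coneQstar p.1 * p.2 j * coneQ p.1)) ⁻¹'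
        quatBox (thinLo ρ δ) (thinHi ρ δ)) := by
    ext p
    simp only [shellProd, fiber, Set.mem_setOf_eq, Set.mem_inter_iff, Set.mem_iInter, Set.mem_preimage]
  rw [e]
  exact h1.inter (MeasurableSet.iInter h2)

/-- The shell event is the preimage of its product form under `x ↦ (x 0, (x 1, x 2, x 3))`. [folklore] -/
theorem shellSet_eq_preimage (ρ δ : ℝ) :
    shellSet ρ δ = (MeasurableEquiv.piFinSuccAbove (fun _ : Fin 4 => ℍ) 0) ⁻¹' shellProd ρ δ := by
  ext x
  exact Iff.rfl

/-- The shell event is measurable. [folklore] -/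
theorem measurableSet_shellSet (ρ δ : ℝ) : MeasurableSet (shellSet ρ δ) := by
  rw [shellSet_eq_preimage]
  exact (measurableSet_shellProd ρ δ).preimage (MeasurableEquiv.measurable _)

/-- **Mass of the shell event** under the product cone measure: `c⁴ · (ρ³/32) · (ρδ²)³ = c⁴ (ρδ)⁶/32` — Fubini over `x 0`,
the fibre over each `x 0` being a product of three rotated boxes of volume `ρδ²` each. [folklore] -/
theorem pi_coneMeasure_shellSet {ρ δ : ℝ} (hρ0 : 0 < ρ) (hρ : ρ ≤ 1 / 16) (hδ : 0 ≤ δ) (hδρ : δ ≤ ρ) :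
    (Measure.pi fun _ : Fin 4 => coneMeasure) (shellSet ρ δ) = ENNReal.ofReal (coneConst ^ 4 * ((ρ * δ) ^ 6 / 32)) := by
  haveI := isProbabilityMeasure_coneMeasure
  have hS := measurableSet_shellProd ρ δ
  rw [shellSet_eq_preimage, (measurePreserving_piFinSuccAbove (fun _ : Fin 4 => coneMeasure) 0).measure_preimage
    hS.nullMeasurableSet, Measure.prod_apply hS]
  -- the sections
  have hsec : ∀ y₀ : ℍ, (Measure.pi fun _ : Fin 3 => coneMeasure) (Prod.mk y₀ ⁻¹' shellProd ρ δ) =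
      (quatBox (axisLo ρ) (axisHi ρ)).indicator
        (fun y₀ => coneMeasure (fiber (thinLo ρ δ) (thinHi ρ δ) y₀) ^ 3) y₀ := by
    intro y₀
    by_cases hy : y₀ ∈ quatBox (axisLo ρ) (axisHi ρ)
    · rw [Set.indicator_of_mem hy]
      have e : Prod.mk y₀ ⁻¹' shellProd ρ δ = Set.pi Set.univ fun _ : Fin 3 => fiber (thinLo ρ δ) (thinHi ρ δ) y₀ := by
        ext f
        simp [shellProd, hy]
      rw [e, Measure.pi_pi, Finset.prod_const, Finset.card_univ, Fintype.card_fin]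
    · rw [Set.indicator_of_notMem hy]
      have e : Prod.mk y₀ ⁻¹' shellProd ρ δ = ∅ := by
        ext f
        simp [shellProd, hy]
      rw [e, measure_empty]
  simp_rw [hsec]
  rw [lintegral_indicator (measurableSet_quatBox _ _)]
  -- on the axis box the fibre mass is constant
  have hthin : volume (quatBox (thinLo ρ δ) (thinHi ρ δ)) = ENNReal.ofReal (ρ * δ ^ 2) := by
    rw [volume_quatBox]
    · congr 1
      simp only [thinLo, thinHi, Matrix.cons_val_zero, Matrix.cons_val_one, Matrix.cons_val]
      ring
    · intro i
      fin_cases i <;> simp [thinLo, thinHi] <;> linarith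
  have haxis : volume (quatBox (axisLo ρ) (axisHi ρ)) = ENNReal.ofReal (ρ ^ 3 / 32) := by
    rw [volume_quatBox]
    · congr 1
      simp only [axisLo, axisHi, Matrix.cons_val_zero, Matrix.cons_val_one, Matrix.cons_val]
      ring
    · intro i
      fin_cases i <;> simp [axisLo, axisHi] <;> linarith
  have hK : ∀ y₀ ∈ quatBox (axisLo ρ) (axisHi ρ),
      coneMeasure (fiber (thinLo ρ δ) (thinHi ρ δ) y₀) ^ 3 = (ENNReal.ofReal coneConst * ENNReal.ofReal (ρ * δ ^ 2)) ^ 3 := by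
    intro y₀ hy
    have hyI : 0 < y₀.imI := (norm_lt_one_of_mem_axis hρ0 hρ hy).2
    rw [coneMeasure_apply (measurableSet_fiber _ _ _) (fiber_subset_ball hρ hδ hδρ hyI), volume_fiber hyI, hthin,
      inv_volume_ball_eq]
  rw [setLIntegral_congr_fun (measurableSet_quatBox _ _) hK, setLIntegral_const,
    coneMeasure_apply (measurableSet_quatBox _ _) (axis_subset_ball hρ0 hρ), haxis, inv_volume_ball_eq]
  have hc : 0 ≤ coneConst := coneConst_pos.le
  rw [← ENNReal.ofReal_mul hc, ← ENNReal.ofReal_mul hc, ← ENNReal.ofReal_pow (by positivity), ← ENNReal.ofReal_mul (by positivity)]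
  congr 1
  ring

end Summit.QuantumFields.YangMills.Theorems.SwapTwistDeficit.ToronLog

end
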